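import Literature.Geometry.Lorentzian.EndCompactificationData
import Literature.Geometry.Lorentzian.InitialDataPullback
import HarnessLib

/-!
# The other ends of `X ∪_e {∞}` (Bray 2001, proof of Thm. 8: "a single harmonically flat end")

Bray, J. Differential Geom. 59 (2001) 177–267, §6, proof of Thm. 8: after the ends other than
the chosen one have been compactified, *"`(M³ ∪ {∞_k}, g̃)` is a complete 3-manifold with
nonnegative scalar curvature with a single harmonically flat end"*. This file transfers an end
`e₁` of `X` which is disjoint from the glued region of the compactified end `e` to an end of
`X ∪_e {∞}` (`AFEnd.Compactification.transferEnd`), and identifies its chart data: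

* `inclOpens`, `exists_diffeomorph_inclOpens` — the image of an open set `V ⊆ X` in
  `X ∪ {∞}` is an open submanifold diffeomorphic to `V` through `incl`;
* `transferEnd e hR' e₁ hdisj : AFEnd (e.Compactification hR')` — the end `incl(e₁)`: open set
  `incl '' e₁.U`, same radius, chart `e₁.chart ∘ incl⁻¹`; it is closed at infinity because
  `e₁.U` misses `far R'` (so the closed far sets of `e₁` stay closed in `X ∪ {∞}`, their
  complement being `incl ''` (an open set) `∪ range cap`);
* `transferEnd_dataChart`, `transferEnd_far` — its inverse chart is `incl ∘ Φ₁` and its far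
  regions are the images of those of `e₁`;
* `hCoeff_transferEnd` — **its chart components for data `D'` on `X ∪ {∞}` are those of `e₁`
  for the pulled-back data `incl^* D'`** (functoriality of the pullback); `comap_incl_eq`,
  `hCoeff_transferEnd_eq` — when `incl^* h' = h₀` (as for the data of
  `AFEnd.exists_compactifiedData`, `h₀ = φ⁴ h`), `incl^* D' = (h₀, 0)` and
  `hCoeff (transferEnd e₁) D' = hCoeff e₁ (h₀, 0)`, so every decay / mass statement phrased
  through `hCoeff` transfers verbatim.

Definitions with bodies and proved theorems; no named facts.

## References

* H. L. Bray, *Proof of the Riemannian Penrose inequality using the positive mass theorem*,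
  J. Differential Geom. 59 (2001) 177–267, §6, proof of Thm. 8. [BrayRPI2001]
* R. Bartnik, *The mass of an asymptotically flat manifold*, Comm. Pure Appl. Math. 39 (1986),
  §1, (1.3). [Bartnik1986]
-/

noncomputable section

open Set Function Metric TopologicalSpace Filter Topology Bundle
open scoped Manifold ContDiff Topology

namespace Literature.Geometry.Lorentzian

open Literature.Topology.FourManifolds Literature.Geometry.Manifold

namespace AFEnd

namespace Compactification

variable {X : Type} [TopologicalSpace X] [ChartedSpace E3 X] [IsManifold (𝓡 3) ∞ X]
  (e : AFEnd X) {R' : ℝ} (hR' : e.R ≤ R')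

/-! ### Open subsets of `X` inside `X ∪ {∞}` -/

/-- The image of an open set `V ⊆ X` in `X ∪_e {∞}`, an open set (`incl` is an open
embedding). [folklore] -/
def inclOpens (V : Opens X) : Opens (e.Compactification hR') :=
  ⟨incl e hR' '' (V : Set X), (isOpenEmbedding_incl e hR').isOpenMap _ V.isOpen⟩

omit [IsManifold (𝓡 3) ∞ X] in
/-- Membership in `inclOpens`. [folklore] -/
theorem mem_inclOpens {V : Opens X} {p : e.Compactification hR'} :
    p ∈ inclOpens e hR' V ↔ ∃ q ∈ (V : Set X), incl e hR' q = p :=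
  Iff.rfl

/-- **`incl(V)` is diffeomorphic to `V` through `incl`**: a diffeomorphism
`θ : V ≅ inclOpens V` with `↑(θ q) = incl q` (both are sources of smooth embeddings onto the
same subset of `X ∪ {∞}`; Lee 2013, Thm. 5.31). [folklore] -/
theorem exists_diffeomorph_inclOpens (V : Opens X) :
    ∃ θ : V ≃ₘ^∞⟮𝓡 3, 𝓡 3⟯ (inclOpens e hR' V),
      ∀ q : V, ((θ q : inclOpens e hR' V) : e.Compactification hR') = incl e hR' q := by
  have h₁ : Manifold.IsSmoothEmbedding (𝓡 3) (𝓡 3) ∞ (incl e hR' ∘ (Subtype.val : V → X)) :=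
    (e.capGlueData hR').isSmoothEmbedding_inl_comp (Manifold.IsSmoothEmbedding.of_opens V)
  have h₂ : Manifold.IsSmoothEmbedding (𝓡 3) (𝓡 3) ∞
      (Subtype.val : inclOpens e hR' V → e.Compactification hR') :=
    Manifold.IsSmoothEmbedding.of_opens _
  have hr : range (incl e hR' ∘ (Subtype.val : V → X)) =
      range (Subtype.val : inclOpens e hR' V → e.Compactification hR') := by
    apply subset_antisymm
    · rintro _ ⟨q, rfl⟩
      exact ⟨⟨incl e hR' q, ⟨q, q.2, rfl⟩⟩, rfl⟩
    · rintro _ ⟨p, rfl⟩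
      obtain ⟨q, hq, hpq⟩ := p.2
      exact ⟨⟨q, hq⟩, hpq⟩
  exact exists_diffeomorph_comp_eq_of_range_eq h₁ h₂ hr

/-! ### Transfer of an end disjoint from the glued region -/

/-- **The end `incl(e₁)` of `X ∪_e {∞}`** for an end `e₁` of `X` whose open set misses the
glued far region `far R'` of `e`: open set `incl '' e₁.U`, radius `e₁.R`, chart
`e₁.chart ∘ incl⁻¹` (through the diffeomorphism of `exists_diffeomorph_inclOpens`). Closedness
at infinity: the closed far sets of `e₁` have images whose complement is
`incl '' (complement) ∪ range cap`, open. Bray 2001, proof of Thm. 8 (the chosen end of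
`M ∪ {∞_k}`). [cite: BrayRPI2001, §6 proof of Thm. 8] -/
def transferEnd (e₁ : AFEnd X) (hdisj : Disjoint (e₁.U : Set X) (e.far R')) :
    AFEnd (e.Compactification hR') where
  U := inclOpens e hR' e₁.U
  R := e₁.R
  R_pos := e₁.R_pos
  chart := (Classical.choose (exists_diffeomorph_inclOpens e hR' e₁.U)).symm.trans e₁.chart
  isClosed_far := fun R'' hR'' ↦ by
    set θ := Classical.choose (exists_diffeomorph_inclOpens e hR' e₁.U) with hθ_def
    have hθ : ∀ q : e₁.U, ((θ q : inclOpens e hR' e₁.U) : e.Compactification hR') = incl e hR' q :=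
      Classical.choose_spec (exists_diffeomorph_inclOpens e hR' e₁.U)
    -- the closed far set of `e₁` and its image
    set C : Set X := ((↑) : e₁.U → X) '' (e₁.chart ⁻¹' {x | R'' ≤ ‖(x : E3)‖}) with hC
    have hCcl : IsClosed C := e₁.isClosed_far R'' hR''
    have hCU : C ⊆ (e₁.U : Set X) := by
      rintro _ ⟨u, -, rfl⟩
      exact u.2
    have heq : ((↑) : inclOpens e hR' e₁.U → e.Compactification hR') ''
        ((θ.symm.trans e₁.chart) ⁻¹' {x | R'' ≤ ‖(x : E3)‖}) = incl e hR' '' C := by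
      apply subset_antisymm
      · rintro _ ⟨p, hp, rfl⟩
        refine ⟨(θ.symm p : X), ⟨θ.symm p, hp, rfl⟩, ?_⟩
        have h := hθ (θ.symm p)
        rw [θ.apply_symm_apply] at h
        exact h.symm
      · rintro _ ⟨_, ⟨u, hu, rfl⟩, rfl⟩
        refine ⟨θ u, ?_, hθ u⟩
        show R'' ≤ ‖(e₁.chart (θ.symm (θ u)) : E3)‖
        rw [θ.symm_apply_apply]
        exact hu
    rw [heq]
    -- the complement of the image is open
    have hcompl : (incl e hR' '' C)ᶜ = incl e hR' '' Cᶜ ∪ range (cap e hR') := by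
      apply subset_antisymm
      · intro p hp
        obtain (⟨q, rfl⟩ | ⟨y, rfl⟩) := (e.capGlueData hR').exists_inl_or_inr p
        · exact Or.inl ⟨q, fun hq ↦ hp ⟨q, hq, rfl⟩, rfl⟩
        · exact Or.inr ⟨y, rfl⟩
      · rintro p (⟨q, hq, rfl⟩ | ⟨y, rfl⟩) ⟨q', hq', hqq'⟩
        · exact hq ((incl_injective e hR' hqq') ▸ hq')
        · have hy : (y : E3) ≠ 0 := (cap_mem_range_incl_iff e hR').1 ⟨q', hqq'⟩
          have h1 : incl e hR' (e.capInv y) = cap e hR' y := incl_capInv e hR' hy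
          have hq'eq : q' = e.capInv y := incl_injective e hR' (hqq'.trans h1.symm)
          have hfar : q' ∈ e.far R' := by
            rw [hq'eq]
            exact e.capInv_mem_far hR' hy (mem_capBall.1 y.2)
          exact absurd hfar (Set.disjoint_left.1 hdisj (hCU hq'))
    rw [← isOpen_compl_iff, hcompl]
    exact ((isOpenEmbedding_incl e hR').isOpenMap _ hCcl.isOpen_compl).union
      (isOpen_range_cap e hR')

variable (e₁ : AFEnd X) (hdisj : Disjoint (e₁.U : Set X) (e.far R'))

/-- The radius of the transferred end is that of `e₁`. [folklore] -/
@[simp] theorem transferEnd_R : (transferEnd e hR' e₁ hdisj).R = e₁.R := rfl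

/-- The open set of the transferred end is `incl '' e₁.U`. [folklore] -/
theorem coe_transferEnd_U :
    ((transferEnd e hR' e₁ hdisj).U : Set (e.Compactification hR')) = incl e hR' '' (e₁.U : Set X) :=
  rfl

/-- **The inverse chart of the transferred end is `incl ∘ Φ₁`.** [folklore] -/
theorem transferEnd_dataChart (y : exteriorRegion e₁.R) :
    (transferEnd e hR' e₁ hdisj).dataChart y = incl e hR' (e₁.dataChart y) :=
  Classical.choose_spec (exists_diffeomorph_inclOpens e hR' e₁.U) (e₁.chart.symm y)

/-- The inverse chart of the transferred end as a composition. [folklore] -/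
theorem transferEnd_dataChart_eq :
    (transferEnd e hR' e₁ hdisj).dataChart = incl e hR' ∘ e₁.dataChart :=
  funext (transferEnd_dataChart e hR' e₁ hdisj)

/-- **The far regions of the transferred end are the images of those of `e₁`.** [folklore] -/
theorem transferEnd_far (R'' : ℝ) :
    (transferEnd e hR' e₁ hdisj).far R'' = incl e hR' '' e₁.far R'' := by
  apply subset_antisymm
  · intro p hp
    obtain ⟨z, hz, rfl⟩ := (transferEnd e hR' e₁ hdisj).mem_far_iff.1 hp
    rw [transferEnd_dataChart]
    exact ⟨e₁.dataChart z, e₁.mem_far_iff.2 ⟨z, hz, rfl⟩, rfl⟩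
  · rintro _ ⟨q, hq, rfl⟩
    obtain ⟨z, hz, rfl⟩ := e₁.mem_far_iff.1 hq
    rw [← transferEnd_dataChart e hR' e₁ hdisj]
    exact (transferEnd e hR' e₁ hdisj).mem_far_iff.2 ⟨z, hz, rfl⟩

/-- The transferred end misses `∞`: its open set lies in the image of `X`. [folklore] -/
theorem transferEnd_U_subset_range_incl :
    ((transferEnd e hR' e₁ hdisj).U : Set (e.Compactification hR')) ⊆ range (incl e hR') := by
  rintro _ ⟨q, -, rfl⟩
  exact mem_range_self q

/-! ### The chart components of the transferred end -/

/-- `incl` is `C^∞` in the degree `∞ + 1` required by pullbacks of data. [folklore] -/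
theorem contMDiff_incl_succ : ContMDiff (𝓡 3) (𝓡 3) (∞ + 1) (incl e hR') := contMDiff_incl e hR'

/-- The differentials of `incl` are injective. [folklore] -/
theorem mfderiv_incl_injective (q : X) :
    Function.Injective (mfderiv (𝓡 3) (𝓡 3) (incl e hR') q) :=
  ((e.capGlueData hR').mfderiv_inl_bijective q).1

/-- **The chart components of the transferred end are those of `e₁` for the pulled-back data**:
`hCoeff (transferEnd e₁) D' = hCoeff e₁ (incl^* D')` (both are pullbacks of `h'`, along
`incl ∘ Φ₁` and along `Φ₁` after `incl`; functoriality of the pullback, O'Neill 1983, Ch. 3,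
p. 58; inside the ball both are the junk value `δ`). [cite: Bartnik1986, (1.3)] -/
theorem hCoeff_transferEnd (D' : InitialDataSet (𝓡 3) (e.Compactification hR')) (x : E3) :
    hCoeff (transferEnd e hR' e₁ hdisj) D' x =
      hCoeff e₁ (D'.comap (incl e hR') (contMDiff_incl_succ e hR') (mfderiv_incl_injective e hR')) x := by
  by_cases hx : e₁.R < ‖x‖
  · have hx' : (transferEnd e hR' e₁ hdisj).R < ‖x‖ := hx
    rw [hCoeff_of_lt D' hx', hCoeff_of_lt _ hx]
    have hincl : MDifferentiable (𝓡 3) (𝓡 3) (incl e hR') :=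
      (contMDiff_incl e hR').mdifferentiable (by simp)
    have hΦ : MDifferentiable (𝓡 3) (𝓡 3) e₁.dataChart :=
      e₁.contMDiff_dataChart.mdifferentiable (by simp)
    have hinner : (D'.comap (incl e hR') (contMDiff_incl_succ e hR')
        (mfderiv_incl_injective e hR')).h.inner =
        pullbackBilin (I := 𝓡 3) (I' := 𝓡 3) (incl e hR') D'.h.inner := by
      funext u
      ext v w
      rfl
    rw [hinner]
    have key : ∀ F : exteriorRegion e₁.R → e.Compactification hR', F = incl e hR' ∘ e₁.dataChart →
        pullbackBilin (I := 𝓡 3) (I' := 𝓡 3) F D'.h.inner ⟨x, hx⟩ =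
          pullbackBilin (I := 𝓡 3) (I' := 𝓡 3) e₁.dataChart
            (pullbackBilin (I := 𝓡 3) (I' := 𝓡 3) (incl e hR') D'.h.inner) ⟨x, hx⟩ := by
      rintro F rfl
      exact congrFun (pullbackBilin_comp hincl hΦ D'.h.inner) ⟨x, hx⟩
    exact key _ (transferEnd_dataChart_eq e hR' e₁ hdisj)
  · have hx' : ¬ (transferEnd e hR' e₁ hdisj).R < ‖x‖ := hx
    unfold hCoeff
    rw [dif_neg hx', dif_neg hx]

/-- **Data on `X ∪ {∞}` whose metric pulls back to `h₀` under `incl` pull back to the data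
`(h₀, 0)`** (time-symmetric case; extensionality of initial data sets). [folklore] -/
theorem comap_incl_eq (D' : InitialDataSet (𝓡 3) (e.Compactification hR'))
    (D₀ : InitialDataSet (𝓡 3) X) (hts' : D'.IsTimeSymmetric) (hts : D₀.IsTimeSymmetric)
    (hA : ∀ (q : X) (v w : TangentSpace (𝓡 3) q),
      D'.h.inner (incl e hR' q) (mfderiv (𝓡 3) (𝓡 3) (incl e hR') q v)
        (mfderiv (𝓡 3) (𝓡 3) (incl e hR') q w) = D₀.h.inner q v w) :
    D'.comap (incl e hR') (contMDiff_incl_succ e hR') (mfderiv_incl_injective e hR') = D₀ :=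
  InitialDataSet.ext' (fun q v w ↦ hA q v w) fun q v w ↦ by
    rw [InitialDataSet.comap_k, hts' (incl e hR' q), hts q]
    rfl

/-- **The chart components of the transferred end are those of `e₁`** when the metric of `D'`
pulls back to `h₀` under `incl`: `hCoeff (transferEnd e₁) D' = hCoeff e₁ D₀` — so the decay
class, the harmonically flat structure and the mass of `e₁` for `(X, h₀)` are those of the
transferred end for `(X ∪ {∞}, h')` (Bray 2001, proof of Thm. 8: the chosen end is untouched by
the compactification of the other ends). [cite: BrayRPI2001, §6 proof of Thm. 8] -/
theorem hCoeff_transferEnd_eq (D' : InitialDataSet (𝓡 3) (e.Compactification hR'))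
    (D₀ : InitialDataSet (𝓡 3) X) (hts' : D'.IsTimeSymmetric) (hts : D₀.IsTimeSymmetric)
    (hA : ∀ (q : X) (v w : TangentSpace (𝓡 3) q),
      D'.h.inner (incl e hR' q) (mfderiv (𝓡 3) (𝓡 3) (incl e hR') q v)
        (mfderiv (𝓡 3) (𝓡 3) (incl e hR') q w) = D₀.h.inner q v w) :
    hCoeff (transferEnd e hR' e₁ hdisj) D' = hCoeff e₁ D₀ := by
  funext x
  rw [hCoeff_transferEnd, comap_incl_eq e hR' D' D₀ hts' hts hA]

end Compactification

end AFEnd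

end Literature.Geometry.Lorentzian

end
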